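import Summits.QuantumFields.BalabanUV.T4Continuum.Spine.NE1p.DressedSmallFieldRecordLabelsKillConvention
import Summits.QuantumFields.BalabanUV.T4Continuum.Spine.NE1p.DressedSmallFieldSlotLettersWitnessEnd

/-!
# T⁴ programme, spine estimate NE1′ (node O3b/H2) — WITNESS «N1a FIRES AT THE CARRIERS OF RECORD»: W91 §3's two ENDs
# `attachedPart_∕muPart_locE_le_of_actOfLetters_recordLabels_any` (the owner's N1a PART 3 with `hkill` DISCHARGED by the kill
# convention) APPLIED ONCE EACH BY NAME on a DECIDED `CoreLetters` family over ROW NE5's LABEL TYPE OF RECORD, for EVERY driven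
# two-run object `D` and every standing scale, and HYPOTHESIS-FREE at the `SU(2)` object of record — ONE LIVE factor of record

Cell `pub-balaban`, sub-cell `t4`, BINDER-OWNERS row NE1′; NE1′ formalisation crew, unit `b2b-balaban-t4-ne1p-formalise-leaf-04`
(gen 17); crew row **W96 ∕ DAG N29zzzzzi** PART 1 of 3 (D1) of `t4/formal/NE1p/LEAVES.md` (BOOKED typer R-T151, `HOME/CLAIMS.log` l.24469;
INTENT l.24458; read X239) = the owner's
OPEN OFFER O-owner-g32-1 («N1a FIRES WITH THE KILL CONVENTION», `CLAIMS.log` 2026-08-20 l.23674; first refusal leaf-04 lineage) taken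
up as a DECIDED APPLIER of the crew's W91 (leaf-05 g12, p243583: the generic kill-convention FACE).  ADDITIVE — imports W91
`Spine/NE1p/DressedSmallFieldRecordLabelsKillConvention` (→ owner N1a P3∕P2∕P1, substrate (A) `SubstrateNestedToriOfRecord`, (B)
`SubstrateSlotActZero`, W-23c `SubstrateBondsOfCubes`) and W58 PART 2 `Spine/NE1p/DressedSmallFieldSlotLettersWitnessEnd` (→ W58 P1:
the live 1×1 Gaussian slot letters `ℓW D`, `PW D`, `tabW`∕`wW`, `ctrW`, `hbase_W`∕`hrdm_W`∕`hrd_W`∕`hctr_W`∕`hbud_W`∕`hmq_W`,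
`actOfLetters_zero_closed`, `letterMass_le`, `hsmall_W`, `DW`∕`UW`; → S30∕S31, W24, W33, W40) ONLY — all LANDED; toy DATA `def`s +
theorems; 0 `def … : Prop`, 0 cite, 0 sorry, 0 `attribute`; W91 §3's two ENDs EXACTLY ONCE each BY NAME; nothing of N1a ∕ N0y ∕ W91 ∕
(A) ∕ (B) ∕ W-23c ∕ S30 ∕ W58 ∕ W24 is restated.

WHAT.
* §1 THE LIVE LABEL OF RECORD (toy DATA): on the coarse torus `tsys 4 N′`, `N′ := R.cubesPerDir (k+1)`, at W24's one-cube domain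
  `X₀ N′`, the FAMILY-branch label `labK := ⟨blk, {blk}, ∅⟩`, `blk := trefineDom L N′ (X₀ N′)` (the refined block covered by itself,
  no bonds) IS A MEMBER of the substrate's `torusLabels hk (X₀ N′)` (`mem_torusLabels_iff` + `image_tcoarse_trefine`) and PASSES the
  owner's filter (`Z₀ = trefineDom … X₀`, `P = ∅`, `#(Z₀ ∖ ∪fam) = 0`).
* §2 THE LETTERS (toy DATA): index families over NE5's label type `InnerLabel R.carriers.Dom (Bnd R)` (one polymer, no cube contour,
  `E1`), the live factor `pK := (domEmb R (k+1) (X₀ N′), InnerLabel.ofTorus hk labK)`, the MASK `χK := 𝟙_{pK}·cK` with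
  `cK := α₆K·e^{−(1·δκK·d(blk))}·e^{−(RcK·(d(blk)+5))}` (N0y's one-family majorant factor at the located clauses
  `(α₆K, δκK, RcK) := ((e·K₀(64,8)·64)⁻¹, 64 log 162 + 1, 2·(64 log 162) + 2)`), and **`ℓK D k hk X j := ℓW D X () with N ↦ χK (X, j)·N`**
  — W58's live Gaussian letters transported to NE5's index and masked: LIVE at `pK`, normalisation letter `0` elsewhere (OUR kill).
* §3 the core of `ℓK` reads W58's core letters (`lam`, `w`, `wB`, `chi`, `readOut`, `q`, `N₁` by `rfl`) and
  **`actOfLetters_ℓK : actOfLetters … ℓK X j o h = χK (X, j) · actOfLetters … (ℓW D) X () o h`** (NE5's `termAt` is linear in `N`).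
* §4 N1a's operator blocks `hm`∕`hN`∕`hq` for `ℓK` from S30 §1's `margin_pos`∕`hN_coreLettersOf`∕`hq_coreLettersOf` at W58's named
  conditions (the mask is a real scalar: `const_mul`), letters `N₀K := χK·gW`, `mqK := (2 − 1·ϑW·1)∕2`, `bqK := 0`.
* §5 **`hAmp_K`** — (B3-form) MET ON EVERY FILTERED LABEL OF RECORD AT ONCE at `s = t = 0`: off `pK` the mask makes the LHS `0`; at
  `labK` it is `cK ×` W58 P2's `letterMass_le` (`(s²t)^{#P} = 1` at `P = ∅`, the family product is the one factor `cK∕α₆K·α₆K`).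
* PART 2 (`…KillWitnessEnd`): §6 W91 §3's attached ∕ μ-part ENDs FIRE ONCE each BY NAME (`killWitnessEnd_fires`, `killWitnessMuEnd_fires`;
  closed forms `≤ 2·K₀(64,8)` ∕ `≤ K₀(64,8)·μ₀∕(2 − μ₀)`); PART 3 (`…KillWitnessLive`): §7 the filtered catalogue sum at `X₀` IS
  `cK·(e^{sW} − 1) ≠ 0`, `killWitnessEnd_live`; §8 HYPOTHESIS-FREE at W58 P2 §7's `DW`∕`UW` (`k = 0`, `hk` is `1 ≤ 1`).

HONEST FRAMING.  A DECIDED TOY ([folklore]; the `def`s are toy DATA): OWNER RIDER (r1) (g38 l.24548,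
verbatim): «kill BY MASK χ = 𝟙_{p⋆}·cK — OURS, by fiat, exactly as W91's `killConv`; (B1b) NOT claimed; `hAmp` MET BY CHOICE of `cK` = N0y's
one-family majorant factor — (B3-form) UNPRINTED for Bałaban's cores (G-ne9p2-5)»; (r2) `labK`'s filter membership is the lattice lemma
`mem_torusLabels_iff` + `image_tcoarse_trefine` (family branch `P = ∅`, `#(Z₀ ∖ ∪fam) = 0 ≤ 2·0`), NOT a reading of p. 12 ∕ p. 18; (r3) a crew W-row —
the owner's N1b (a kill predicate READ FROM PRINT) stays RESERVED.  W58's OWN 1×1 Gaussian letters at ONE factor of record, every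
other factor's normalisation letter masked to `0` BY FIAT — the kill is OURS exactly as `killConv`'s is the owner's convention; `labK ∈
torusLabels` is lattice bookkeeping on the substrate's CONSTRUCTED tori of record; (B1b) NOT claimed — nothing identifies Bałaban's
resummed (2.14) terms with these letters (NE5's READING of p. 12 untouched); (B3-form) `hAmp` MET because `cK` is CHOSEN as N0y's
majorant factor — UNPRINTED for Bałaban's cores (GAPS G-ne9p2-5); every numeral OURS over pv22's located `K₀(64,8)`∕`64 log 162`;
printed loci ([Balaban1988RGII] pp. 12, 18) TYPE∕CONTEXT only; 0 binders instantiated on Bałaban's (2.14) densities; no wall item; wall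
v1.8 (T4-DAG v48–v54) — words, not kind — does NOT move; R-t4r2-Q2 NOT met thereby; NE1′ ⇐ the named binders — NOT printed, NOT
proved; spine PROVED 0∕9; count 9 unchanged.  ABSOLUTE RULE honoured.  Rung (B)+1 on ONE finite four-torus — NOT infinite volume, NOT a
mass gap, NOT OS on ℝ⁴, NOT Clay.  HONEST DEPENDENCY: continuum YM on T⁴ ⇐ BetaPertH ∧ nine spine estimates (0/9 proved); BetaPertH ⇐
(D1) ∧ (D4) ∧ CAP+tail; G-an2-4 gates asym, D1 and NE2/3/4.
-/

noncomputable section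
namespace Summit.QuantumFields.BalabanUV.T4Continuum.NE1p.DressedSmallFieldRecordLabelsKillWitness

open Set Metric MeasureTheory Complex
open scoped BigOperators
open Literature.MathematicalPhysics.QuantumFieldTheory.Balaban1983to89
open Literature.MathematicalPhysics.QuantumFieldTheory.Balaban1983to89.B12TreeDecay (K₀ K₀_pos)
open Literature.MathematicalPhysics.QuantumFieldTheory.Balaban1983to89.B13Resummation (locE)
open Literature.MathematicalPhysics.QuantumFieldTheory.Balaban1983to89.TreeLengthTorus (TDom tsys torusTreeLen torusTreeLen_singleton torusTreeLen_nonneg)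
open Literature.MathematicalPhysics.QuantumFieldTheory.Balaban1983to89.TreeLengthTorusGeometry (tgeometry TTouch)
open Summit.QuantumFields.BalabanUV.T4Continuum.B13HistDatum (level136)
open Summit.QuantumFields.BalabanUV.T4Continuum.B13HistMeasurable (MeasPotFrame B13HistM)
open Summit.QuantumFields.BalabanUV.T4Continuum.B13HistReadout (VppCLMM VppCLMM_apply)
open Summit.QuantumFields.BalabanUV.T4Continuum.B13HistWitness (toyConsts toy_posUnits level136_toy)
open Summit.QuantumFields.BalabanUV.T4Continuum.B13Carriers (TwoRuns singleDom singleDom_val)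
open Summit.QuantumFields.BalabanUV.T4Continuum.B13StepTermLabels (InnerLabel innerLabels)
open Summit.QuantumFields.BalabanUV.T4Continuum.B13InnerData (Bnd b13InnerData)
open Summit.QuantumFields.BalabanUV.T4Continuum.B13DomainGeometryTR (domEmb domEmb_apply)
open Summit.QuantumFields.BalabanUV.T4Continuum.B13TermParamGaussianBi (BiCore)
open Summit.QuantumFields.BalabanUV.T4Continuum.B13TermContours (wB₁)
open Summit.QuantumFields.BalabanUV.T4Continuum.SubstrateTwoRunsDriven (DrivenRuns)
open Summit.QuantumFields.BalabanUV.T4Continuum.SubstrateActivities (CoreLetters coreOf actOfLetters actOfLetters_apply)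
open Summit.QuantumFields.BalabanUV.T4Continuum.SubstrateGaussianLetters (gaussC)
open Summit.QuantumFields.BalabanUV.T4Continuum.SubstrateNestedToriOfRecord (InnerLabel.ofTorus InnerLabel.ofTorus_injective torusLabels mem_torusLabels_iff)
open Summit.QuantumFields.BalabanUV.T4Continuum.SubstrateBondsOfCubes (bondsOfFineCubes)
open Summit.QuantumFields.BalabanUV.T4Continuum.TorusBlockRefinement (trefineDom trefineDom_val image_tcoarse_trefine)
open Summit.QuantumFields.BalabanUV.T4Continuum.NE1p.DressedSmallFieldCoresWitness (E1 Acst Acst_pos)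
open Summit.QuantumFields.BalabanUV.T4Continuum.NE1p.DressedSmallFieldTorusWitness (X₀ X₀_val eq_X₀_iff hrate_torus_num exp_locE_cube)
open Summit.QuantumFields.BalabanUV.T4Continuum.NE1p.DressedSmallFieldOnCoresSlotLetters (margin_pos hN_coreLettersOf hq_coreLettersOf)
open Summit.QuantumFields.BalabanUV.T4Continuum.NE1p.DressedSmallFieldSlotLettersWitness
open Summit.QuantumFields.BalabanUV.T4Continuum.NE1p.DressedSmallFieldSlotLettersWitnessEnd
open Summit.QuantumFields.BalabanUV.T4Continuum.NE1p.DressedSmallFieldRecordLabelsKillConvention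
  (attachedPart_locE_le_of_actOfLetters_recordLabels_any muPart_locE_le_of_actOfLetters_recordLabels_any)

variable {G : Type} [GaugeGroup G] (D : DrivenRuns G) (k : ℕ)

/-! ## §1 The live label of record at W24's one-cube domain (toy DATA) -/

/-- The refined block under W24's one-cube coarse domain `X₀ (R.cubesPerDir (k+1))` (all `L⁴` fine cubes). [folklore] -/
def blkK : TDom 4 (D.F.L * D.cubesPerDir (k + 1)) := trefineDom D.F.L (D.cubesPerDir (k + 1)) (X₀ (D.cubesPerDir (k + 1)))

/-- **THE LIVE LABEL** `labK := ⟨blk, {blk}, ∅⟩` — row NE5's label TYPE of record, family branch (the block covered by itself, no bonds). [folklore] -/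
def labK : InnerLabel (TDom 4 (D.F.L * D.cubesPerDir (k + 1))) (Bnd D.toTwoRuns) := ⟨blkK D k, {blkK D k}, ∅⟩

/-- The live label's `Z₀` is the refined block. [folklore] -/
@[simp] theorem labK_Z₀ : (labK D k).Z₀ = blkK D k := rfl
/-- The live label's family is the block itself. [folklore] -/
@[simp] theorem labK_fam : (labK D k).fam = {blkK D k} := rfl
/-- The live label carries no bonds. [folklore] -/
@[simp] theorem labK_P : (labK D k).P = ∅ := rfl

variable (hk : k + 1 + D.m' ≤ D.F.m + D.K)

/-- **`labK` IS A LABEL OF RECORD**: a member of the substrate's `torusLabels hk (X₀ N′)` (well-formedness read torus-side: the one family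
member sits inside `Z₀`, no bonds, and the block projects onto `X₀` — `image_tcoarse_trefine`). [folklore] -/
theorem labK_mem_torusLabels : labK D k ∈ torusLabels hk (X₀ (D.cubesPerDir (k + 1))) := by
  rw [mem_torusLabels_iff]
  refine ⟨fun Y hY => ?_, by simp, ?_⟩
  · rw [labK_fam, Finset.mem_singleton] at hY; rw [hY, labK_Z₀]
  · rw [labK_Z₀, blkK, trefineDom_val, image_tcoarse_trefine]

/-- **`labK` PASSES THE OWNER's FILTER** at `X₀`: `Z₀ = trefineDom … X₀`, `P = ∅ ⊆ …`, `#(Z₀ ∖ ∪fam) = 0 ≤ 2·0`. [folklore] -/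
theorem labK_filter :
    (labK D k).Z₀ = trefineDom D.F.L (D.cubesPerDir (k + 1)) (X₀ (D.cubesPerDir (k + 1))) ∧
      (labK D k).P ⊆ bondsOfFineCubes hk ((labK D k).Z₀.1 \ (labK D k).fam.biUnion
        fun Y : (tsys 4 (D.F.L * D.cubesPerDir (k + 1))).Dom => Y.1) ∧
      ((labK D k).Z₀.1 \ (labK D k).fam.biUnion fun Y : (tsys 4 (D.F.L * D.cubesPerDir (k + 1))).Dom => Y.1).card ≤
        2 * (labK D k).P.card := by
  refine ⟨rfl, by simp, ?_⟩
  simp [labK]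

open Classical in
/-- `labK` is a member of the owner-FILTERED torus labels at `X₀`. [folklore] -/
theorem labK_mem_filter :
    labK D k ∈ (torusLabels hk (X₀ (D.cubesPerDir (k + 1)))).filter fun ℓ =>
      ℓ.Z₀ = trefineDom D.F.L (D.cubesPerDir (k + 1)) (X₀ (D.cubesPerDir (k + 1))) ∧
        ℓ.P ⊆ bondsOfFineCubes hk (ℓ.Z₀.1 \ ℓ.fam.biUnion fun Y : (tsys 4 (D.F.L * D.cubesPerDir (k + 1))).Dom => Y.1) ∧
        (ℓ.Z₀.1 \ ℓ.fam.biUnion fun Y : (tsys 4 (D.F.L * D.cubesPerDir (k + 1))).Dom => Y.1).card ≤ 2 * ℓ.P.card :=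
  Finset.mem_filter.2 ⟨labK_mem_torusLabels D k hk, labK_filter D k hk⟩

/-! ## §2 The letters over row NE5's label type: W58's live Gaussian letters, MASKED to one factor of record (toy DATA) -/

/-- Polymer-family type per factor: ONE polymer (as W58). [folklore] -/
abbrev 𝒵K : D.carriers.Dom → InnerLabel D.carriers.Dom (Bnd D.toTwoRuns) → Type := fun _ _ => Unit
/-- … at the factor's own carrier domain. [folklore] -/
abbrev domK : ∀ (X : D.carriers.Dom) (j : InnerLabel D.carriers.Dom (Bnd D.toTwoRuns)), 𝒵K D X j → D.carriers.Dom := fun X _ _ => X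
/-- No cube contour. [folklore] -/
abbrev JcK : D.carriers.Dom → InnerLabel D.carriers.Dom (Bnd D.toTwoRuns) → Type := fun _ _ => PEmpty.{1}
/-- One real Gaussian variable. [folklore] -/
abbrev VK : D.carriers.Dom → InnerLabel D.carriers.Dom (Bnd D.toTwoRuns) → Type := fun _ _ => E1

/-- **THE LIVE FACTOR OF RECORD** `pK := (domEmb R (k+1) (X₀ N′), InnerLabel.ofTorus hk labK)`. [folklore] -/
def pK : D.carriers.Dom × InnerLabel D.carriers.Dom (Bnd D.toTwoRuns) :=
  (domEmb D.toTwoRuns (k + 1) (X₀ (D.cubesPerDir (k + 1))), InnerLabel.ofTorus hk (labK D k))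

/-- Located clause letter `Rc := 2·(64 log 162) + 2` (= `Rkp`; W24's torus rate numerals). [folklore] -/
def RcK : ℝ := 2 * (64 * Real.log 162) + 2
/-- Located clause letter `α₆ := (e·K₀(64,8)·64)⁻¹` ((2.29)-clause `h229` with equality). [folklore] -/
def α₆K : ℝ := (Real.exp 1 * K₀ 64 8 * 64)⁻¹
/-- Located clause letter `δκ := 64 log 162 + 1` (`hκ` with equality at `δ := 1`). [folklore] -/
def δκK : ℝ := 64 * Real.log 162 + 1
/-- `0 < α₆K`. [folklore] -/
theorem α₆K_pos : 0 < α₆K := by unfold α₆K; have := K₀_pos (64 : ℝ) 8; positivity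

/-- **THE MASK VALUE** `cK` — N0y's one-family majorant factor at `labK` (CHOSEN; (B3-form) is thereby MET, not derived). [folklore] -/
def cK : ℝ := α₆K * Real.exp (-(1 * δκK * torusTreeLen (blkK D k).1)) * Real.exp (-(RcK * (torusTreeLen (blkK D k).1 + 5)))
/-- `0 < cK`. [folklore] -/
theorem cK_pos : 0 < cK D k := by unfold cK; have := α₆K_pos; positivity

/-- `α₆K ≤ 81∕64` (`e ≥ 1`, `K₀(64,8) ≥ 1∕81` as in W24's `dressedConst_le_one`). [folklore] -/
theorem α₆K_le : α₆K ≤ 81 / 64 := by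
  unfold α₆K
  have he : 1 ≤ Real.exp 1 := Real.one_le_exp zero_le_one
  have hK : 1 / 81 ≤ K₀ (64 : ℝ) 8 := by
    unfold K₀
    rw [show (((8 : ℕ) : ℝ) + 1) ^ 2 = 81 by norm_num]
    exact div_le_div_of_nonneg_right (Real.one_le_exp (B12TreeDecay.kappa₀_nonneg (by norm_num) _)) (by norm_num)
  rw [inv_le_comm₀ (by have := K₀_pos (64 : ℝ) 8; positivity) (by norm_num)]
  nlinarith [K₀_pos (64 : ℝ) 8]
/-- `cK ≤ α₆K·e^{−10}` (the located `Rc ≥ 2` against the `+5`). [folklore] -/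
theorem cK_le : cK D k ≤ α₆K * Real.exp (-10) := by
  unfold cK
  have h1 : Real.exp (-(1 * δκK * torusTreeLen (blkK D k).1)) ≤ 1 := by
    rw [Real.exp_le_one_iff, neg_nonpos, one_mul]; unfold δκK
    exact mul_nonneg (by positivity) (torusTreeLen_nonneg _)
  have hR : 2 ≤ RcK := by unfold RcK; have := Real.log_nonneg (by norm_num : (1 : ℝ) ≤ 162); nlinarith
  have h2 : Real.exp (-(RcK * (torusTreeLen (blkK D k).1 + 5))) ≤ Real.exp (-10) :=
    Real.exp_le_exp.2 (by nlinarith [torusTreeLen_nonneg (blkK D k).1])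
  calc α₆K * Real.exp (-(1 * δκK * torusTreeLen (blkK D k).1)) * Real.exp (-(RcK * (torusTreeLen (blkK D k).1 + 5)))
      ≤ α₆K * 1 * Real.exp (-10) :=
        mul_le_mul (mul_le_mul_of_nonneg_left h1 α₆K_pos.le) h2 (Real.exp_pos _).le (mul_nonneg α₆K_pos.le zero_le_one)
    _ = α₆K * Real.exp (-10) := by ring
/-- `cK < 1`. [folklore] -/
theorem cK_lt_one : cK D k < 1 := by
  have h10 : Real.exp (-10) ≤ (11 : ℝ)⁻¹ := by
    rw [Real.exp_neg]
    exact inv_anti₀ (by norm_num) (by have := Real.add_one_le_exp (10 : ℝ); norm_num at this ⊢; linarith)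
  have := cK_le D k
  nlinarith [α₆K_le, α₆K_pos, Real.exp_pos (-10 : ℝ)]

open Classical in
/-- **THE MASK** `χK p := cK` at the live factor `pK`, `0` at every other factor. [folklore] -/
def χK (p : D.carriers.Dom × InnerLabel D.carriers.Dom (Bnd D.toTwoRuns)) : ℝ := if p = pK D k hk then cK D k else 0

/-- The mask at the live factor is `cK`. [folklore] -/
theorem χK_pK : χK D k hk (pK D k hk) = cK D k := if_pos rfl
/-- The mask vanishes off the live factor. [folklore] -/
theorem χK_of_ne {p : D.carriers.Dom × InnerLabel D.carriers.Dom (Bnd D.toTwoRuns)} (h : p ≠ pK D k hk) : χK D k hk p = 0 := if_neg h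
/-- The mask is nonnegative. [folklore] -/
theorem χK_nonneg (p : D.carriers.Dom × InnerLabel D.carriers.Dom (Bnd D.toTwoRuns)) : 0 ≤ χK D k hk p := by
  unfold χK; split_ifs; exacts [(cK_pos D k).le, le_rfl]

/-- **THE LETTERS** `ℓK D k hk X j := ℓW D X () with N ↦ χK (X, j)·N` — W58's live 1×1 Gaussian slot letters (`rW = 32∕A`, table `[2]`,
read-out `ϑW`, no χ-constraint) transported to row NE5's label index and MASKED (toy DATA). [folklore] -/
def ℓK : ∀ (X : D.carriers.Dom) (j : InnerLabel D.carriers.Dom (Bnd D.toTwoRuns)), CoreLetters (PW D) ℂ (𝒵K D) (domK D) (JcK D) (VK D) X j :=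
  fun X j =>
  { κ₁ := ((ℓW D) X ()).κ₁
    κ₁_pos := ((ℓW D) X ()).κ₁_pos
    r := ((ℓW D) X ()).r
    one_lt_r := ((ℓW D) X ()).one_lt_r
    N := fun o a => (χK D k hk (X, j) : ℂ) * ((ℓW D) X ()).N o a
    q := ((ℓW D) X ()).q
    cons := ((ℓW D) X ()).cons
    nsign := ((ℓW D) X ()).nsign
    B := ((ℓW D) X ()).B
    measB := ((ℓW D) X ()).measB }

/-! ## §3 The core of `ℓK` reads W58's core letters; the activity is the MASKED activity -/

section Core
variable (X : D.carriers.Dom) (j : InnerLabel D.carriers.Dom (Bnd D.toTwoRuns))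

/-- The core of `ℓK` has W58's parameter measure (`rfl`). [folklore] -/
theorem lam_coreK : (coreOf (PW D) ℂ (𝒵K D) (domK D) (JcK D) (VK D) (ℓK D k hk) X j).lam =
    (coreOf (PW D) ℂ (𝒵W D) (domW D) (JcW D) (VW D) (ℓW D) X ()).lam := rfl
/-- … W58's Cauchy weight (`rfl`). [folklore] -/
theorem w_coreK : (coreOf (PW D) ℂ (𝒵K D) (domK D) (JcK D) (VK D) (ℓK D k hk) X j).w =
    (coreOf (PW D) ℂ (𝒵W D) (domW D) (JcW D) (VW D) (ℓW D) X ()).w := rfl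
/-- … W58's weight letter `wB` (`rfl`). [folklore] -/
theorem wB_coreK : (coreOf (PW D) ℂ (𝒵K D) (domK D) (JcK D) (VK D) (ℓK D k hk) X j).wB =
    (coreOf (PW D) ℂ (𝒵W D) (domW D) (JcW D) (VW D) (ℓW D) X ()).wB := rfl
/-- … W58's potential-free factor (`rfl`: no χ-constraint on either side). [folklore] -/
theorem chi_coreK : (coreOf (PW D) ℂ (𝒵K D) (domK D) (JcK D) (VK D) (ℓK D k hk) X j).chi =
    (coreOf (PW D) ℂ (𝒵W D) (domW D) (JcW D) (VW D) (ℓW D) X ()).chi := rfl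
/-- … W58's history read-out (`rfl`). [folklore] -/
theorem readOut_coreK : (coreOf (PW D) ℂ (𝒵K D) (domK D) (JcK D) (VK D) (ℓK D k hk) X j).readOut =
    (coreOf (PW D) ℂ (𝒵W D) (domW D) (JcW D) (VW D) (ℓW D) X ()).readOut := rfl
/-- … W58's exponent letter (`rfl`). [folklore] -/
theorem q_coreK : (coreOf (PW D) ℂ (𝒵K D) (domK D) (JcK D) (VK D) (ℓK D k hk) X j).q =
    (coreOf (PW D) ℂ (𝒵W D) (domW D) (JcW D) (VW D) (ℓW D) X ()).q := rfl
/-- … W58's read-out letter `N₁` (`rfl`). [folklore] -/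
theorem N₁_coreK : (coreOf (PW D) ℂ (𝒵K D) (domK D) (JcK D) (VK D) (ℓK D k hk) X j).N₁ =
    (coreOf (PW D) ℂ (𝒵W D) (domW D) (JcW D) (VW D) (ℓW D) X ()).N₁ := rfl
/-- … and the MASKED normalisation letter (`rfl`). [folklore] -/
theorem N_coreK : (coreOf (PW D) ℂ (𝒵K D) (domK D) (JcK D) (VK D) (ℓK D k hk) X j).N =
    fun o a => (χK D k hk (X, j) : ℂ) * (coreOf (PW D) ℂ (𝒵W D) (domW D) (JcW D) (VW D) (ℓW D) X ()).N o a := rfl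
/-- The normalisation letter of `ℓK` is the masked one of `ℓW` (`rfl`). [folklore] -/
theorem N_ℓK (o : ℂ) (a : (PEmpty.{1} ⊕ Unit) → ℝ × ℝ) : ((ℓK D k hk) X j).N o a = (χK D k hk (X, j) : ℂ) * ((ℓW D) X ()).N o a := rfl
/-- The exponent letter of `ℓK` is `ℓW`'s (`rfl`). [folklore] -/
theorem q_ℓK : ((ℓK D k hk) X j).q = ((ℓW D) X ()).q := rfl

/-- **THE ACTIVITY OF RECORD OF `ℓK` IS THE MASKED ACTIVITY OF W58's LETTERS**: `actOfLetters … ℓK X j o h = χK (X, j) · actOfLetters …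
(ℓW D) X () o h` — NE5's `termAt` `∫ w·N·(∫ chi·e^{readOut}·e^{−q}) dlam` is linear in the normalisation letter; every other letter of
the two cores agrees (`rfl`). [folklore] -/
theorem actOfLetters_ℓK (o : ℂ) (h : B13HistM (PW D)) :
    actOfLetters (PW D) ℂ (𝒵K D) (domK D) (JcK D) (VK D) (ℓK D k hk) X j o h =
      (χK D k hk (X, j) : ℂ) * actOfLetters (PW D) ℂ (𝒵W D) (domW D) (JcW D) (VW D) (ℓW D) X () o h := by
  rw [actOfLetters_apply, actOfLetters_apply]
  unfold BiCore.termAt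
  rw [lam_coreK, w_coreK, chi_coreK, readOut_coreK, q_coreK, N_coreK, ← integral_const_mul]
  refine integral_congr_ae (Filter.Eventually.of_forall fun p => ?_)
  simp only []
  ring

end Core

/-! ## §4 N1a's operator-letter blocks for `ℓK` from S30 §1 at W58's named conditions -/

/-- The normalisation bound of W58's live letter on the class ball (S30 §1's `gaussC·√(max 1 (1!·2¹ + 2))` at the 1×1 table). [folklore] -/
def gW : ℝ := gaussC (Fin 1) * Real.sqrt (max 1 ((Fintype.card (Fin 1)).factorial * (2 : ℝ) ^ Fintype.card (Fin 1) + 2))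

/-- N1a's letter `N₀` for `ℓK`: the mask times W58's bound. [folklore] -/
def N₀K (_ : ℕ) (p : D.carriers.Dom × InnerLabel D.carriers.Dom (Bnd D.toTwoRuns)) (_ : D.carriers.Dom) : ℝ := χK D k hk p * gW
/-- N1a's margin letter `mq := (2 − 1·ϑW·1)∕2` (S30 §1's at W58's `γ = 2`, `card = 1`, `R′ = 1`). [folklore] -/
def mqK (_ : ℕ) (_ : D.carriers.Dom × InnerLabel D.carriers.Dom (Bnd D.toTwoRuns)) (_ : D.carriers.Dom) : ℝ := (2 - 1 * ϑW * 1) / 2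
/-- N1a's letter `bq := 0`. [folklore] -/
def bqK (_ : ℕ) (_ : D.carriers.Dom × InnerLabel D.carriers.Dom (Bnd D.toTwoRuns)) (_ : D.carriers.Dom) : ℝ := 0

/-- `hm`: the margin letter is positive (`ϑW = 1`: `mq = 1∕2`). [folklore] -/
theorem hm_K : ∀ k', ∀ g ∈ (Set.univ : Set (ℕ → ℝ)), ∀ (U : D.carriers.BgB) (X : D.carriers.Dom), D.carriers.scale X = k' →
    ∀ p : D.carriers.Dom × InnerLabel D.carriers.Dom (Bnd D.toTwoRuns), 0 < mqK D k' p X := by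
  intro _ _ _ _ _ _ _; unfold mqK ϑW; norm_num

/-- **`hN` FOR `ℓK`** — S30 §1's `hN_coreLettersOf` at W58's `hbase_W`∕`hrdm_W`∕`hrd_W`∕`hctr_W`∕`hbud_W` ONCE, then the real mask
(`const_mul`; the bound scales by `χK ≥ 0`). [folklore] -/
theorem hN_K : ∀ k', ∀ g ∈ (Set.univ : Set (ℕ → ℝ)), ∀ (U : D.carriers.BgB) (X : D.carriers.Dom), D.carriers.scale X = k' →
    ∀ p : D.carriers.Dom × InnerLabel D.carriers.Dom (Bnd D.toTwoRuns),
    (∀ o ∈ ball ((ctrW D) k' g U).1 ((fun _ : ℕ => (1 : ℝ)) k'),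
      AEStronglyMeasurable (((ℓK D k hk) p.1 p.2).N o) (coreOf (PW D) ℂ (𝒵K D) (domK D) (JcK D) (VK D) (ℓK D k hk) p.1 p.2).lam) ∧
    (∀ a, DifferentiableOn ℂ (fun o => ((ℓK D k hk) p.1 p.2).N o a) (ball ((ctrW D) k' g U).1 ((fun _ : ℕ => (1 : ℝ)) k'))) ∧
    (∀ o ∈ ball ((ctrW D) k' g U).1 ((fun _ : ℕ => (1 : ℝ)) k'), ∀ a, ‖((ℓK D k hk) p.1 p.2).N o a‖ ≤ N₀K D k hk k' p X) := by
  intro k' g hg U X hX p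
  obtain ⟨h1, h2, h3⟩ := hN_coreLettersOf D (PW D) ℂ (𝒵W D) (domW D) (JcW D) (VW D) (mIW D) (AW D) (W := Set.univ) (ctr := (ctrW D))
    (R' := fun _ => 1) (β₀ := fun _ _ => 2) (ϑ := fun _ _ => ϑW) (d₀ := fun _ _ => 2) (γ := fun _ _ => 2)
    (fun _ => zero_le_one) (hbase_W D) (hrdm_W D) (fun _ _ => by norm_num) (fun _ _ => by norm_num) (hrd_W D) (hctr_W D) (hbud_W D)
    k' g hg U X hX (p.1, ())
  refine ⟨fun o ho => (h1 o ho).const_mul _, fun a => (h2 a).const_mul _, fun o ho a => ?_⟩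
  rw [N_ℓK, norm_mul, Complex.norm_real, Real.norm_of_nonneg (χK_nonneg D k hk _)]
  unfold N₀K gW
  exact mul_le_mul_of_nonneg_left (by simpa using h3 o ho a) (χK_nonneg D k hk _)

/-- **`hq` FOR `ℓK`** — S30 §1's `hq_coreLettersOf` at W58's named conditions ONCE (the quadratic-form letter is W58's unchanged). [folklore] -/
theorem hq_K : ∀ k', ∀ g ∈ (Set.univ : Set (ℕ → ℝ)), ∀ (U : D.carriers.BgB) (X : D.carriers.Dom), D.carriers.scale X = k' →
    ∀ p : D.carriers.Dom × InnerLabel D.carriers.Dom (Bnd D.toTwoRuns),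
    (∀ o ∈ ball ((ctrW D) k' g U).1 ((fun _ : ℕ => (1 : ℝ)) k'),
      AEStronglyMeasurable (Function.uncurry (((ℓK D k hk) p.1 p.2).q o))
        ((coreOf (PW D) ℂ (𝒵K D) (domK D) (JcK D) (VK D) (ℓK D k hk) p.1 p.2).lam.prod volume)) ∧
    (∀ a v, DifferentiableOn ℂ (fun o => ((ℓK D k hk) p.1 p.2).q o a v) (ball ((ctrW D) k' g U).1 ((fun _ : ℕ => (1 : ℝ)) k'))) ∧
    (∀ o ∈ ball ((ctrW D) k' g U).1 ((fun _ : ℕ => (1 : ℝ)) k'), ∀ a v,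
      mqK D k' p X * ‖v‖ ^ 2 - bqK D k' p X ≤ (((ℓK D k hk) p.1 p.2).q o a v).re) := by
  intro k' g hg U X hX p
  obtain ⟨h1, h2, h3⟩ := hq_coreLettersOf D (PW D) ℂ (𝒵W D) (domW D) (JcW D) (VW D) (mIW D) (AW D) (W := Set.univ) (ctr := (ctrW D))
    (R' := fun _ => 1) (β₀ := fun _ _ => 2) (ϑ := fun _ _ => ϑW) (d₀ := fun _ _ => 2) (γ := fun _ _ => 2)
    (hbase_W D) (hrdm_W D) (hrd_W D) (hctr_W D) k' g hg U X hX (p.1, ())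
  refine ⟨h1, h2, fun o ho a v => ?_⟩
  have h := h3 o ho a v
  simp only [Fintype.card_fin, Nat.cast_one] at h
  unfold mqK bqK
  exact h

/-! ## §5 (B3-form) `hAmp` MET on every filtered label of record at once (`s = t = 0`) -/

/-- The tree length of the embedded one-cube domain is `0`. [folklore] -/
theorem d_domEmb_X₀ : D.carriers.d (domEmb D.toTwoRuns (k + 1) (X₀ (D.cubesPerDir (k + 1)))) = 0 := by
  rw [domEmb_apply]
  show torusTreeLen (X₀ (D.cubesPerDir (k + 1))).1 = 0
  rw [X₀_val]; exact torusTreeLen_singleton 0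

open Classical in
/-- At `X₀`, a filtered label's factor is the live factor iff the label is `labK` (`InnerLabel.ofTorus` injective). [folklore] -/
theorem factor_eq_pK_iff (ℓ : InnerLabel (TDom 4 (D.F.L * D.cubesPerDir (k + 1))) (Bnd D.toTwoRuns)) :
    (domEmb D.toTwoRuns (k + 1) (X₀ (D.cubesPerDir (k + 1))), InnerLabel.ofTorus hk ℓ) = pK D k hk ↔ ℓ = labK D k := by
  constructor
  · intro h
    exact InnerLabel.ofTorus_injective hk (Prod.mk.inj h).2
  · rintro rfl; rfl

open Classical in
/-- **(B3-form) `hAmp` FOR `ℓK`, MET** [decided toy]: for every torus domain `Z ⊆ X₀` (hence `Z = X₀`, W24 `eq_X₀_iff`) and every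
owner-filtered label of record `ℓ`, the letter mass of `ℓK`'s core at `(domEmb Z, ofTorus ℓ)` with N1a's letters `N₀K`∕`mqK`∕`bqK`
at radius `2` against `w := wW D` is `≤ A·(Π_{Y∈fam} α₆K e^{−δκ d(Y)} e^{−Rc(d(Y)+5)})·(0²·0)^{#P}`: off `labK` both the mask and
hence the LHS vanish; AT `labK` the LHS is `cK ×` W58 P2's `letterMass_le` (`≤ A := Acst`), the RHS is `A·cK·1`. [folklore] -/
theorem hAmp_K : ∀ Z : (tsys 4 (D.cubesPerDir (k + 1))).Dom, Z.1 ⊆ (X₀ (D.cubesPerDir (k + 1))).1 →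
    ∀ ℓ ∈ (torusLabels hk Z).filter fun ℓ =>
        ℓ.Z₀ = trefineDom D.F.L (D.cubesPerDir (k + 1)) Z ∧
          ℓ.P ⊆ bondsOfFineCubes hk (ℓ.Z₀.1 \ ℓ.fam.biUnion fun Y : (tsys 4 (D.F.L * D.cubesPerDir (k + 1))).Dom => Y.1) ∧
          (ℓ.Z₀.1 \ ℓ.fam.biUnion fun Y : (tsys 4 (D.F.L * D.cubesPerDir (k + 1))).Dom => Y.1).card ≤ 2 * ℓ.P.card,
      (coreOf (PW D) ℂ (𝒵K D) (domK D) (JcK D) (VK D) (ℓK D k hk) (domEmb D.toTwoRuns (k + 1) Z) (InnerLabel.ofTorus hk ℓ)).lam.real univ *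
          ((coreOf (PW D) ℂ (𝒵K D) (domK D) (JcK D) (VK D) (ℓK D k hk) (domEmb D.toTwoRuns (k + 1) Z) (InnerLabel.ofTorus hk ℓ)).wB *
              N₀K D k hk (k + 1) (domEmb D.toTwoRuns (k + 1) Z, InnerLabel.ofTorus hk ℓ) (domEmb D.toTwoRuns (k + 1) Z) *
            Real.exp (bqK D (k + 1) (domEmb D.toTwoRuns (k + 1) Z, InnerLabel.ofTorus hk ℓ) (domEmb D.toTwoRuns (k + 1) Z))) *
          (Real.pi / (mqK D (k + 1) (domEmb D.toTwoRuns (k + 1) Z, InnerLabel.ofTorus hk ℓ) (domEmb D.toTwoRuns (k + 1) Z) / 2)) ^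
            (Module.finrank ℝ ((VK D) (domEmb D.toTwoRuns (k + 1) Z) (InnerLabel.ofTorus hk ℓ)) / 2 : ℝ) *
        Real.exp ((coreOf (PW D) ℂ (𝒵K D) (domK D) (JcK D) (VK D) (ℓK D k hk) (domEmb D.toTwoRuns (k + 1) Z) (InnerLabel.ofTorus hk ℓ)).N₁ *
          (‖(0 : B13HistM (PW D))‖ + 2 * ‖(wW D)‖)) ≤
      Acst * ((∏ Y ∈ ℓ.fam, (α₆K * Real.exp (-(1 * δκK * torusTreeLen Y.1)) *
        Real.exp (-(RcK * (torusTreeLen Y.1 + 5))))) * ((0 : ℝ) ^ 2 * 0) ^ ℓ.P.card) := by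
  intro Z hZ ℓ hℓ
  have hZX : Z = X₀ (D.cubesPerDir (k + 1)) := (eq_X₀_iff _ Z).1 ((Finset.Nonempty.subset_singleton_iff Z.2.1).1 hZ)
  subst hZX
  by_cases hl : ℓ = labK D k
  · -- the live label: `cK ×` W58's letter mass
    subst hl
    have hp : (domEmb D.toTwoRuns (k + 1) (X₀ (D.cubesPerDir (k + 1))), InnerLabel.ofTorus hk (labK D k)) = pK D k hk := rfl
    unfold N₀K bqK mqK
    have hfin : (Module.finrank ℝ ((VK D) (domEmb D.toTwoRuns (k + 1) (X₀ (D.cubesPerDir (k + 1)))) (InnerLabel.ofTorus hk (labK D k))) / 2 : ℝ)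
        = (1 : ℝ) / 2 := by
      rw [show Module.finrank ℝ ((VK D) (domEmb D.toTwoRuns (k + 1) (X₀ (D.cubesPerDir (k + 1)))) (InnerLabel.ofTorus hk (labK D k)))
        = Module.finrank ℝ E1 from rfl, finrank_euclideanSpace, Fintype.card_fin, Nat.cast_one]
    have hcK : cK D k = α₆K * Real.exp (-(1 * δκK * torusTreeLen (blkK D k).1)) * Real.exp (-(RcK * (torusTreeLen (blkK D k).1 + 5))) := rfl
    have hgW : gW = (Real.sqrt (2 * Real.pi))⁻¹ ^ 1 * Real.sqrt (max 1 (1 * 2 ^ 1 + 2)) := by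
      unfold gW gaussC; rw [Fintype.card_fin, Nat.factorial_one]; norm_num
    rw [hp, χK_pK, lam_coreK, wB_coreK, N₁_coreK, lam_real_univ, wB_core, N₁_core, d_domEmb_X₀, level136_toy, labK_fam, labK_P,
      Finset.prod_singleton, Finset.card_empty, pow_zero, hfin, ← hcK, hgW]
    have hmass := letterMass_le D
    have hA : (0 : ℝ) + 2 * (Acst / 2) = Acst := by ring
    rw [hA] at hmass
    simp only [mul_one, one_mul, pow_one, Real.exp_zero, norm_zero, zero_add] at hmass ⊢
    have h2 := mul_le_mul_of_nonneg_left hmass (cK_pos D k).le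
    linarith [h2]
  · -- a dead label: the mask vanishes
    have hp : (domEmb D.toTwoRuns (k + 1) (X₀ (D.cubesPerDir (k + 1))), InnerLabel.ofTorus hk ℓ) ≠ pK D k hk :=
      fun h => hl ((factor_eq_pK_iff D k hk ℓ).1 h)
    unfold N₀K
    rw [χK_of_ne D k hk hp, zero_mul, mul_zero, zero_mul, mul_zero, zero_mul, zero_mul]
    refine mul_nonneg Acst_pos.le (mul_nonneg (Finset.prod_nonneg fun Y _ => ?_) (pow_nonneg (by norm_num) _))
    have := α₆K_pos; positivity

end Summit.QuantumFields.BalabanUV.T4Continuum.NE1p.DressedSmallFieldRecordLabelsKillWitness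

end
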